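import Mathlib
import HarnessLib
import Literature.Probability.Process.PointStationaryLaw
import Literature.MathematicalPhysics.StatisticalMechanics.RootEnergy
import Literature.MathematicalPhysics.StatisticalMechanics.LennardJonesClusters
import Literature.MathematicalPhysics.StatisticalMechanics.BarlowStacking
import Literature.Geometry.DiscreteGeometry.KissingPatterns

/-!
# Skeleton line `periodic-window-support` — crux `LayeredLawsChargePeriodic`
# (piece 2 of the BC2 redirect of `GroundStatesChargePeriodic`, stmt-AtomisticToContinuum-2911;
# route `BenjaminiSchrammPeriodicSupport`, sub-problem `Crystallization`)

Idea.  `LayeredLawsChargePeriodic` asks that a minimising point-stationary hard-core law `P` which is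
a.s. LAYERED (every point close-packed, one global bond chart from an ideal Barlow stacking) charges
ONE periodic configuration `Q` at every scale — Radin's "the ground-state measure has a periodic
configuration in its support", asked of layered laws only and WITHOUT deciding hcp vs fcc vs polytype.
The line moves the crux to SYMBOLIC COORDINATES.  An exactly relaxed layered configuration is coded
by an in-layer spacing `a`, a height sequence `t : ℤ → ℝ` (interlayer spacings free, they relax near
stacking faults) and a Hägg word `s : ℤ → {±1}` (lateral registry is fixed by the three-fold symmetry):
`layeredStacking a t s`.  Three stubs:

* `stub_exactLayered` (RIGIDITY, XL): a minimising point-stationary layered law is a.s. an EXACT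
  rotated, re-based relaxed layered stacking `A (layeredStacking a t s − c)` — law-level strict
  second-order rigidity of close-packed LJ stackings (every Barlow stacking is mechanically stable;
  a stationary distortion field costs energy at second order), the word-agnostic analogue of the
  sibling stub `stub_hcpTubeRigidity` of `LayeredLawsSelectHcp/Lines/mtp_prestress_split_ergodic_frame`.
* `stub_periodicWindowCharged` (SELECTION IN SUPPORT, L/XL, the heart and the TRANSFER `C⁺`): for such
  a law there are ONE periodic reference (`a₀`, periodic word `w`, periodic height increments `t₀`)
  such that, for every tolerance `η` and window length `L`, with positive probability the root's
  `L`-window of the word reads a shift of `w` and the spacings are `η`-close to the reference ones.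
  Why easier than the crux: point-stationarity becomes shift-stationarity of the word/spacing law seen
  from the root layer, the energy is an explicit shift-invariant functional `e(s,t)` of the coded
  sequence (lattice sums), and "minimising stationary word laws charge periodic windows" is 1-D
  ground-state theory: finite-range 1-D interactions have PERIODIC ground states (Radin–Schulman 1983),
  degenerate couplings give i.i.d.-like word laws that charge every periodic window anyway, and only a
  devil's-staircase regime of infinitely many competing couplings (Bak–Bruinsma 1982) — not the
  `J₂`-dominated, `r⁻⁶`-summable LJ layer couplings — produces uniquely ergodic aperiodic minimisers.
  No hcp-vs-fcc inequality is needed: `w` is existential.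
* `stub_windowMatching` (DETERMINISTIC GEOMETRY, M): the periodic reference is a
  `PeriodicConfiguration 3` and an exact layered stacking whose window of length `L(R)` around the
  root's layer reads `w` with spacings `η(R,ε)`-close to `t₀` is two-way `ε`-matched on `B(0,R)` with
  the rotated re-based reference — index by index, label differences inside the window agree
  (`haggLabel_add_natCast`), so positions differ by `O(R)·η`.

Composition `LayeredLawsChargePeriodic_of` (real proof): rigidity feeds selection; selection gives
the reference and the charged window events; geometry gives `Q` (chosen before `R, ε`) and, per
`(R, ε)`, an inclusion of events; monotonicity of (outer) measure finishes.

Disproof used: none registered for this new crux yet (`Cruxes/GroundStatesChargePeriodic` has no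
`Disproof.lean`); the sibling disproof facts honoured: `cubicRootNull_false_without_energy`
(LayeredLawsSelectHcp/Disproof) — the energy hypothesis `E_P[h] ≤ e*` is consumed by
`stub_periodicWindowCharged` (without it the i.i.d.-fault laws at higher energy are layered,
point-stationary and charge every window, so the stub would even stay true, but `stub_exactLayered`
would fail: unrelaxed random stackings are not minimising); `not_shellsToFccChart` — the word stays
existential.

This file states the crux verbatim as `LayeredLawsChargePeriodic` (definitionally the route's child
decl once the split `GroundStatesChargePeriodic ↦ {MinimiserShells, LayeredLawsChargePeriodic}` is
rendered, and `Cruxes/GroundStatesChargePeriodic/Pieces.lean`'s decl of the same name, `Iff.rfl`).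
-/

namespace Summit.AtomisticToContinuum.Crystallization.Cruxes.GroundStatesChargePeriodic.PeriodicWindowSupport

noncomputable section

open scoped Topology ENNReal
open Filter Set MeasureTheory Literature.MathematicalPhysics.StatisticalMechanics
  Literature.Probability.Process

/-- Local shorthand for `ℝ³`. -/
abbrev E3 : Type := EuclideanSpace ℝ (Fin 3)

/-! ## The crux (verbatim) -/

/-- **The crux `LayeredLawsChargePeriodic`** (piece 2 of the redirect of stmt-AtomisticToContinuum-2911),
verbatim. -/
def LayeredLawsChargePeriodic : Prop :=
  ∀ δ : ℝ, 0 < δ → ∀ P : MeasureTheory.Measure (MeasureTheory.Measure (EuclideanSpace ℝ (Fin 3))), MeasureTheory.IsProbabilityMeasure P → (∀ᵐ μ ∂P, Literature.Probability.Process.IsRootedHardCore δ μ) → Literature.Probability.Process.IsPointStationaryLaw P → (∫ μ, Literature.MathematicalPhysics.StatisticalMechanics.rootEnergy Literature.MathematicalPhysics.StatisticalMechanics.lennardJones μ ∂P) ≤ (⨅ Q : Literature.MathematicalPhysics.StatisticalMechanics.PeriodicConfiguration 3, Q.energyPerParticle Literature.MathematicalPhysics.StatisticalMechanics.lennardJones)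 → (∀ᵐ μ ∂P, ∃ S : Set (EuclideanSpace ℝ (Fin 3)), μ = (MeasureTheory.Measure.count : MeasureTheory.Measure (EuclideanSpace ℝ (Fin 3))).restrict S ∧ (∀ x ∈ S, (∃ a : ℝ, 9 / 10 ≤ a ∧ a ≤ 1 ∧ ∃ T : Finset (EuclideanSpace ℝ (Fin 3)), (↑T : Set (EuclideanSpace ℝ (Fin 3))) = (fun y : EuclideanSpace ℝ (Fin 3) => y - x) '' {y : EuclideanSpace ℝ (Fin 3) | y ∈ S ∧ y ≠ x ∧ dist y x ≤ 5 / 4 * a} ∧ (Literature.Geometry.DiscreteGeometry.ShellCloseTo (a / 100) T (Finset.image (fun v : EuclideanSpace ℝ (Fin 3) => a • v) Literature.Geometry.DiscreteGeometry.fccKissingPattern) ∨ Literature.Geometry.DiscreteGeometry.ShellCloseTo (a / 100) T (Finset.image (fun v : EuclideanSpace ℝ (Fin 3) => a • v) Literature.Geometry.DiscreteGeometry.hcpKissingPattern)))) ∧ (∃ s : ℤ → ℤ, Literature.MathematicalPhysics.StatisticalMechanics.IsHaggSeq s ∧ ∃ Φ : EuclideanSpace ℝ (Fin 3) → EuclideanSpace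 ℝ (Fin 3), Set.BijOn Φ (Literature.MathematicalPhysics.StatisticalMechanics.barlowStacking 1 (Real.sqrt (2 / 3)) s) S ∧ ∀ p ∈ Literature.MathematicalPhysics.StatisticalMechanics.barlowStacking 1 (Real.sqrt (2 / 3)) s, ∀ q ∈ Literature.MathematicalPhysics.StatisticalMechanics.barlowStacking 1 (Real.sqrt (2 / 3)) s, (dist p q = 1 ↔ (0 < dist (Φ p) (Φ q) ∧ dist (Φ p) (Φ q) ≤ 28 / 25)))) → ∃ Q : Literature.MathematicalPhysics.StatisticalMechanics.PeriodicConfiguration 3, ∀ R ε : ℝ, 0 < R → 0 < ε → 0 < P {μ | ∃ A : EuclideanSpace ℝ (Fin 3) →ₗᵢ[ℝ] EuclideanSpace ℝ (Fin 3), ∃ q ∈ Q.points, (∀ s ∈ Q.points, dist s q ≤ R → ∃ y : EuclideanSpace ℝ (Fin 3), μ {y} ≠ 0 ∧ dist y (A (s - q)) ≤ ε) ∧ (∀ y : EuclideanSpace ℝ (Fin 3), μ {y} ≠ 0 → ‖y‖ ≤ R → ∃ s ∈ Q.points, dist y (A (s - q)) ≤ ε)}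

/-! ## Symbolic coordinates: exactly relaxed layered stackings -/

/-- The point `(i, j)` of layer `k` of the RELAXED layered stacking with in-layer spacing `a`, height
sequence `t` and Hägg word `s`: `i u_a + j v_a + (haggLabel s k) w_a + (t k) e₃` (for `t k = k h` this
is `barlowPos a h s k i j`). -/
def layeredPos (a : ℝ) (t : ℤ → ℝ) (s : ℤ → ℤ) (k i j : ℤ) : E3 :=
  (i : ℝ) • triangularVec₁ a + (j : ℝ) • triangularVec₂ a +
    (haggLabel s k : ℝ) • barlowOffset a + (t k) • layerNormal 1

/-- The relaxed layered stacking `{layeredPos a t s k i j}` as a point set. -/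
def layeredStacking (a : ℝ) (t : ℤ → ℝ) (s : ℤ → ℤ) : Set E3 :=
  {x | ∃ k i j : ℤ, x = layeredPos a t s k i j}

/-- Sanity: uniform heights give the Literature Barlow stacking. -/
theorem layeredPos_eq_barlowPos (a h : ℝ) (s : ℤ → ℤ) (k i j : ℤ) :
    layeredPos a (fun k => (k : ℝ) * h) s k i j = barlowPos a h s k i j := by
  simp only [layeredPos, barlowPos, layerNormal]
  congr 1
  ext l
  fin_cases l <;> simp

/-- **The rooted counting measure of an exact relaxed layered stacking, rotated by `A` and re-based at
its point `(k₀, i₀, j₀)`.** -/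
def exactLaw (A : E3 →ₗᵢ[ℝ] E3) (a : ℝ) (t : ℤ → ℝ) (s : ℤ → ℤ) (k₀ i₀ j₀ : ℤ) : Measure E3 :=
  (Measure.count : Measure E3).restrict
    ((fun z : E3 => A (z - layeredPos a t s k₀ i₀ j₀)) '' layeredStacking a t s)

/-- `μ` IS an exact rotated re-based relaxed layered stacking (some `A`, `a > 0`, heights `t` with
interlayer spacings `≥ 1/2` — close-packed layers at scale `a ∈ [9/10, 1]` are `≈ a√(2/3) ≥ 0.72`
apart, so `1/2` is a safe one-sided interface constant — Hägg word `s`, root label `(k₀, i₀, j₀)`). -/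
def IsExactLayered (μ : Measure E3) : Prop :=
  ∃ A : E3 →ₗᵢ[ℝ] E3, ∃ a : ℝ, ∃ t : ℤ → ℝ, ∃ s : ℤ → ℤ, ∃ k₀ i₀ j₀ : ℤ,
    0 < a ∧ (∀ k, 1 / 2 ≤ t (k + 1) - t k) ∧ IsHaggSeq s ∧ μ = exactLaw A a t s k₀ i₀ j₀

/-- **The window event**: `μ` is an exact relaxed layered stacking whose in-layer spacing is
`η`-close to `a₀` and whose word and spacings, read on the `L` layers above and below the ROOT's
layer, agree with a shift of the reference word `w` and are `η`-close to the reference spacings of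
`t₀`. -/
def WindowEvent (a₀ : ℝ) (t₀ : ℤ → ℝ) (w : ℤ → ℤ) (η : ℝ) (L : ℕ) : Set (Measure E3) :=
  {μ | ∃ A : E3 →ₗᵢ[ℝ] E3, ∃ a : ℝ, ∃ t : ℤ → ℝ, ∃ s : ℤ → ℤ, ∃ k₀ i₀ j₀ m : ℤ,
    0 < a ∧ (∀ k, 1 / 2 ≤ t (k + 1) - t k) ∧ IsHaggSeq s ∧ |a - a₀| ≤ η ∧
    (∀ k : ℤ, |k| ≤ L → s (k₀ + k) = w (m + k) ∧
      |(t (k₀ + k + 1) - t (k₀ + k)) - (t₀ (m + k + 1) - t₀ (m + k))| ≤ η) ∧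
    μ = exactLaw A a t s k₀ i₀ j₀}

/-- **The matching event of the crux** at scale `(R, ε)` for the periodic configuration `Q`
(verbatim the set in the conclusion of `LayeredLawsChargePeriodic`). -/
def MatchEvent (Q : PeriodicConfiguration 3) (R ε : ℝ) : Set (Measure E3) :=
  {μ | ∃ A : EuclideanSpace ℝ (Fin 3) →ₗᵢ[ℝ] EuclideanSpace ℝ (Fin 3), ∃ q ∈ Q.points, (∀ s ∈ Q.points, dist s q ≤ R → ∃ y : EuclideanSpace ℝ (Fin 3), μ {y} ≠ 0 ∧ dist y (A (s - q)) ≤ ε) ∧ (∀ y : EuclideanSpace ℝ (Fin 3), μ {y} ≠ 0 → ‖y‖ ≤ R → ∃ s ∈ Q.points, dist y (A (s - q)) ≤ ε)}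

/-! ## The three registered stubs -/

/-- **STUB 1 — `stub_exactLayered` (RIGIDITY of minimising layered laws; XL, word-agnostic analogue of
the sibling's `stub_hcpTubeRigidity`).**  A minimising point-stationary hard-core law that is a.s.
layered (every point `(a/100)`-close-packed at a scale `a ∈ [9/10, 1]`, one global bond chart from an
ideal Barlow stacking) is a.s. an EXACT rotated re-based relaxed layered stacking
`A (layeredStacking a t s − c)`: uniform in-layer spacing, symmetric `A/B/C` registry, free heights.
Why plausibly true: every close-packed LJ stacking is strictly mechanically stable, so a stationary
distortion field on top of the charted configuration costs energy at second order (mass transport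
kills the first order, as in the landed `CorrMeanZero` files of the sibling line) while `E_P[h] ≤ e*`
leaves no room; heights stay free because faults DO relax the spacings.  Why it might fail: only if
some close-packed stacking had a zero-energy distortion mode at law level (none is known), or if
`e* < inf over layered laws` (then the stub is vacuous, not false). -/
theorem stub_exactLayered :
    ∀ δ : ℝ, 0 < δ → ∀ P : Measure (Measure E3), IsProbabilityMeasure P →
      (∀ᵐ μ ∂P, IsRootedHardCore δ μ) → IsPointStationaryLaw P →
      (∫ μ, rootEnergy lennardJones μ ∂P) ≤
        (⨅ Q : PeriodicConfiguration 3, Q.energyPerParticle lennardJones) →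
      (∀ᵐ μ ∂P, ∃ S : Set E3, μ = (Measure.count : Measure E3).restrict S ∧
        (∀ x ∈ S, (∃ a : ℝ, 9 / 10 ≤ a ∧ a ≤ 1 ∧ ∃ T : Finset E3,
          (↑T : Set E3) = (fun y : E3 => y - x) '' {y : E3 | y ∈ S ∧ y ≠ x ∧ dist y x ≤ 5 / 4 * a} ∧
          (Literature.Geometry.DiscreteGeometry.ShellCloseTo (a / 100) T
              (Finset.image (fun v : E3 => a • v) Literature.Geometry.DiscreteGeometry.fccKissingPattern) ∨
            Literature.Geometry.DiscreteGeometry.ShellCloseTo (a / 100) T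
              (Finset.image (fun v : E3 => a • v) Literature.Geometry.DiscreteGeometry.hcpKissingPattern)))) ∧
        (∃ s : ℤ → ℤ, IsHaggSeq s ∧ ∃ Φ : E3 → E3,
          Set.BijOn Φ (barlowStacking 1 (Real.sqrt (2 / 3)) s) S ∧
          ∀ p ∈ barlowStacking 1 (Real.sqrt (2 / 3)) s, ∀ q ∈ barlowStacking 1 (Real.sqrt (2 / 3)) s,
            (dist p q = 1 ↔ (0 < dist (Φ p) (Φ q) ∧ dist (Φ p) (Φ q) ≤ 28 / 25)))) →
      ∀ᵐ μ ∂P, IsExactLayered μ := by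
  sorry

/-- **STUB 2 — `stub_periodicWindowCharged` (SELECTION IN SUPPORT, symbolic coordinates; L/XL; the
TRANSFER `C⁺` of the crux and its heart).**  A minimising point-stationary hard-core law that is a.s.
an exact relaxed layered stacking charges ONE periodic reference at every window length: there are
`a₀ > 0`, a period `p`, a `p`-periodic Hägg word `w` and reference heights `t₀` with positive
`p`-periodic increments such that for every `η > 0` and `L` the window event has positive
`P`-measure.  Why plausibly true / why easier: seen from the root layer the law of `(s, t)` is
shift-stationary and `E_P[h]` is the mean of an explicit shift-invariant lattice-sum functional, so
minimising laws are carried by ground-state sequences of a 1-D effective layer interaction with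
summable, `J₂`-dominated couplings; periodic ground states exist for every finite-range truncation
(Radin–Schulman 1983) and degenerate couplings only enlarge the set of charged windows; `w` is
EXISTENTIAL, so no hcp-vs-fcc-vs-polytype inequality is claimed.  Why it might fail: a
devil's-staircase regime (Bak–Bruinsma 1982; Aubry) of infinitely many competing effective couplings
would make the minimising word laws uniquely ergodic and aperiodic (Sturmian), charging no fixed
periodic word at all lengths — excluded for LJ only through quantitative control of the `r⁻⁶` layer
couplings (cf. items 0670/0737, uncertified). -/
theorem stub_periodicWindowCharged :
    ∀ δ : ℝ, 0 < δ → ∀ P : Measure (Measure E3), IsProbabilityMeasure P →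
      (∀ᵐ μ ∂P, IsRootedHardCore δ μ) → IsPointStationaryLaw P →
      (∫ μ, rootEnergy lennardJones μ ∂P) ≤
        (⨅ Q : PeriodicConfiguration 3, Q.energyPerParticle lennardJones) →
      (∀ᵐ μ ∂P, IsExactLayered μ) →
      ∃ a₀ : ℝ, 0 < a₀ ∧ ∃ p : ℕ, p ≠ 0 ∧ ∃ w : ℤ → ℤ, IsHaggSeq w ∧ (∀ i, w (i + p) = w i) ∧
        ∃ t₀ : ℤ → ℝ, (∀ k, 0 < t₀ (k + 1) - t₀ k) ∧ (∀ k, t₀ (k + 1 + p) - t₀ (k + p) = t₀ (k + 1) - t₀ k) ∧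
        ∀ η : ℝ, 0 < η → ∀ L : ℕ, 0 < P (WindowEvent a₀ t₀ w η L) := by
  sorry

/-- **STUB 3 — `stub_windowMatching` (DETERMINISTIC GEOMETRY; M).**  A periodic reference
(`a₀ > 0`, `p`-periodic Hägg word `w`, heights `t₀` with positive `p`-periodic increments) is the point
set of a `PeriodicConfiguration 3` (lattice `ℤu + ℤv + ℤ(W w + H e₃)`, motif `p` points, as in
`barlowPeriodicConfiguration`), and for all `R, ε > 0` there are `η > 0` and `L` such that every law in
the window event is in the matching event of the crux at `(R, ε)`: take the same rotation `A` and the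
base point `q = layeredPos a₀ t₀ w m i₀ j₀`; inside the window the label differences of `s` and of the
shifted `w` agree (`haggLabel_add_natCast`), so corresponding points differ by at most `C·R·η/a₀`
(index-by-index, cf. the landed `dist_barlowPos_barlowPos_le` of `PalmToHinge`); reference points
within `R` of `q` lie in layers `|k' − m| ≤ R / min_k (t₀ (k+1) − t₀ k)` and atoms within `R` of the
root lie in layers `|k − k₀| ≤ 2R` (all spacings are `≥ 1/2`), so `L = ⌈R / d_min⌉ + ⌈2R⌉ + 1` sees
every point that has to be matched.  Why it might fail: it does not; bookkeeping only. -/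
theorem stub_windowMatching :
    ∀ a₀ : ℝ, 0 < a₀ → ∀ p : ℕ, p ≠ 0 → ∀ w : ℤ → ℤ, IsHaggSeq w → (∀ i, w (i + p) = w i) →
      ∀ t₀ : ℤ → ℝ, (∀ k, 0 < t₀ (k + 1) - t₀ k) →
        (∀ k, t₀ (k + 1 + p) - t₀ (k + p) = t₀ (k + 1) - t₀ k) →
      ∃ Q : PeriodicConfiguration 3, Q.points = layeredStacking a₀ t₀ w ∧
        ∀ R ε : ℝ, 0 < R → 0 < ε → ∃ η : ℝ, 0 < η ∧ ∃ L : ℕ,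
          WindowEvent a₀ t₀ w η L ⊆ MatchEvent Q R ε := by
  sorry

/-! ## The composition (real proof) -/

/-- **SKELETON THEOREM — the crux `LayeredLawsChargePeriodic` from the three stubs.**  Rigidity puts
the law a.s. in symbolic coordinates; selection-in-support gives ONE periodic reference whose window
events are charged; the geometry turns the reference into a periodic configuration `Q` (chosen before
`R, ε`) and each window event into a sub-event of the matching event; monotonicity of the (outer)
measure finishes. -/
theorem LayeredLawsChargePeriodic_of_stubs
    (h1 : ∀ δ : ℝ, 0 < δ → ∀ P : Measure (Measure E3), IsProbabilityMeasure P →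
      (∀ᵐ μ ∂P, IsRootedHardCore δ μ) → IsPointStationaryLaw P →
      (∫ μ, rootEnergy lennardJones μ ∂P) ≤
        (⨅ Q : PeriodicConfiguration 3, Q.energyPerParticle lennardJones) →
      (∀ᵐ μ ∂P, ∃ S : Set E3, μ = (Measure.count : Measure E3).restrict S ∧
        (∀ x ∈ S, (∃ a : ℝ, 9 / 10 ≤ a ∧ a ≤ 1 ∧ ∃ T : Finset E3,
          (↑T : Set E3) = (fun y : E3 => y - x) '' {y : E3 | y ∈ S ∧ y ≠ x ∧ dist y x ≤ 5 / 4 * a} ∧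
          (Literature.Geometry.DiscreteGeometry.ShellCloseTo (a / 100) T
              (Finset.image (fun v : E3 => a • v) Literature.Geometry.DiscreteGeometry.fccKissingPattern) ∨
            Literature.Geometry.DiscreteGeometry.ShellCloseTo (a / 100) T
              (Finset.image (fun v : E3 => a • v) Literature.Geometry.DiscreteGeometry.hcpKissingPattern)))) ∧
        (∃ s : ℤ → ℤ, IsHaggSeq s ∧ ∃ Φ : E3 → E3,
          Set.BijOn Φ (barlowStacking 1 (Real.sqrt (2 / 3)) s) S ∧
          ∀ p ∈ barlowStacking 1 (Real.sqrt (2 / 3)) s, ∀ q ∈ barlowStacking 1 (Real.sqrt (2 / 3)) s,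
            (dist p q = 1 ↔ (0 < dist (Φ p) (Φ q) ∧ dist (Φ p) (Φ q) ≤ 28 / 25)))) →
      ∀ᵐ μ ∂P, IsExactLayered μ)
    (h2 : ∀ δ : ℝ, 0 < δ → ∀ P : Measure (Measure E3), IsProbabilityMeasure P →
      (∀ᵐ μ ∂P, IsRootedHardCore δ μ) → IsPointStationaryLaw P →
      (∫ μ, rootEnergy lennardJones μ ∂P) ≤
        (⨅ Q : PeriodicConfiguration 3, Q.energyPerParticle lennardJones) →
      (∀ᵐ μ ∂P, IsExactLayered μ) →
      ∃ a₀ : ℝ, 0 < a₀ ∧ ∃ p : ℕ, p ≠ 0 ∧ ∃ w : ℤ → ℤ, IsHaggSeq w ∧ (∀ i, w (i + p) = w i) ∧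
        ∃ t₀ : ℤ → ℝ, (∀ k, 0 < t₀ (k + 1) - t₀ k) ∧ (∀ k, t₀ (k + 1 + p) - t₀ (k + p) = t₀ (k + 1) - t₀ k) ∧
        ∀ η : ℝ, 0 < η → ∀ L : ℕ, 0 < P (WindowEvent a₀ t₀ w η L))
    (h3 : ∀ a₀ : ℝ, 0 < a₀ → ∀ p : ℕ, p ≠ 0 → ∀ w : ℤ → ℤ, IsHaggSeq w → (∀ i, w (i + p) = w i) →
      ∀ t₀ : ℤ → ℝ, (∀ k, 0 < t₀ (k + 1) - t₀ k) →
        (∀ k, t₀ (k + 1 + p) - t₀ (k + p) = t₀ (k + 1) - t₀ k) →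
      ∃ Q : PeriodicConfiguration 3, Q.points = layeredStacking a₀ t₀ w ∧
        ∀ R ε : ℝ, 0 < R → 0 < ε → ∃ η : ℝ, 0 < η ∧ ∃ L : ℕ,
          WindowEvent a₀ t₀ w η L ⊆ MatchEvent Q R ε) :
    LayeredLawsChargePeriodic := by
  intro δ hδ P hP hcore hstat hmin hlay
  -- rigidity: a.s. the law is an exact relaxed layered stacking
  have hexact : ∀ᵐ μ ∂P, IsExactLayered μ := h1 δ hδ P hP hcore hstat hmin hlay
  -- selection in support: ONE periodic reference whose window events are all charged
  obtain ⟨a₀, ha₀, p, hp, w, hw, hwp, t₀, ht₀, ht₀p, hcharge⟩ :=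
    h2 δ hδ P hP hcore hstat hmin hexact
  -- geometry: the reference is a periodic configuration `Q`, chosen before `R, ε`
  obtain ⟨Q, -, hmatch⟩ := h3 a₀ ha₀ p hp w hw hwp t₀ ht₀ ht₀p
  refine ⟨Q, fun R ε hR hε => ?_⟩
  obtain ⟨η, hη, L, hsub⟩ := hmatch R ε hR hε
  -- the charged window event is a sub-event of the matching event
  exact (hcharge η hη L).trans_le (measure_mono hsub)

/-- **The crux BY NAME from the three registered stubs** (`sorry` only inside the stubs). -/
theorem LayeredLawsChargePeriodic_of : LayeredLawsChargePeriodic :=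
  LayeredLawsChargePeriodic_of_stubs stub_exactLayered stub_periodicWindowCharged stub_windowMatching

end

end Summit.AtomisticToContinuum.Crystallization.Cruxes.GroundStatesChargePeriodic.PeriodicWindowSupport
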